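import Summits.BirchSwinnertonDyer.Rank2.CountingDoorKernel
import Summits.BirchSwinnertonDyer.Rank2.F2DensityAlgebra
import Literature.NumberTheory.EllipticCurves.BhargavaHo2022.TwoMarkedPoints
import HarnessLib

/-!
# BirchSwinnertonDyer / CountingDoorF2AtThree — support for crux I1 `SelmerThreeAverageLargeF2`
# (stmt-BirchSwinnertonDyer-19440): the `#Sel_p = p²`-DENSITY KERNEL and the CAPPED first moment
# (route-free kernel; the by-name levers are in `CountingDoorF2AtThreeSelmerNineLevers.lean`)

Route `route-BirchSwinnertonDyer-CountingDoorF2AtThree` (cell bsd-rank2; TWIN leaf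
`PAdicBSDRankTwoPositiveProportion`). After the closure of I4loc (`SchneiderOnDoorSubfamily`,
p463209) the leaf hinges on the two XL cruxes I1 (`∀ Φ large, limsup avg #Sel₃ ≤ 36`) and I2
(`w = +1` with lower density `> 1/6`), which the bridge `Theorems.leaf_of_local` consumes ONLY on the
door family and ONLY through the first-moment inequality. This file isolates, over the tree's
vocabulary (`BhargavaHo2022/TwoMarkedPoints`, `Rank2/F2DensityAlgebra`, `Rank2/CountingDoorKernel`)
and for an arbitrary prime `p`, exactly what that inequality delivers and what the door consumes:

* §1 density-algebra complements: member-relative monotonicity (`proportionOn_mono_mem`,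
  `densityOnGE_mono_mem`, `hasDensityOn_one_mono_mem`, `hasPositiveLowerDensityOn_mono_mem`),
  nonempty height balls from a positive (lower) density (`eventually_card_below_pos_of_densityOnGE`,
  `…_of_hasPositiveLowerDensityOn`), and the **capped first moment**
  `averageOnLE_min : limsup avg f ≤ c → limsup avg (min f M) ≤ c` — I1 implies its CAPPED form
  `Φ.AverageOnLE (fun a ↦ min #Sel₃(E_a) 81) 36`, a statement about the DISTRIBUTION of `#Sel₃` on
  the levels `9, 27, 81` only (no tail / uniformity content).
* §2 `natCard_torsionBy_eq_one_of_torsionOrder_eq_one`: trivial rational torsion (the I0 / BH22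
  Thm. 10.1 clause `torsionOrder = 1`) kills `E(ℚ)[n]` for every `n ≠ 0`; density-one adapters.
* §3 **the `#Sel_p = p²` density from the CAPPED average** (first moment + Dokchitser–Dokchitser
  parity, K2 `Rank2.card_selmerGroup_bounds_of_rootNumber`, K3
  `Rank2.hasPositiveLowerDensityOn_of_memberwise_bounds` with `f = min (#Sel_p) p⁴`, levels
  `(0, p³, p⁴)`): on any `Φ` on which `rank ≥ 2 ∧ #E(ℚ)[p] = 1` holds for `100 %`,
  `limsup avg min(#Sel_p, p⁴) ≤ A`, `liminf dens(w = +1) ≥ ρ > 0` and `A < p³ + (p⁴ − p³)ρ`, the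
  members with `#Sel_p(E_a) = p²` have POSITIVE LOWER DENSITY
  (`hasPositiveLowerDensityOn_card_selmerGroup_eq_sq_of_cappedAverage`; at `p = 3`:
  `hasPositiveLowerDensityOn_selmerNine_of_cappedAverage`, threshold `A < 27 + 54ρ`).
* §4 **the door consumes only that density**: for any `100 %` property `Good` and any property
  `Leaf` with a member-wise door `Good a → #Sel_p(E_a) = p² → Leaf a`, a positive lower density of
  `#Sel_p = p²` gives a positive lower density of `Leaf` — NO root number, NO parity, NO average
  (`hasPositiveLowerDensityOn_of_door_of_card_selmerGroup_eq_sq`); composed with §3: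
  `hasPositiveLowerDensityOn_of_door_of_cappedAverage`.
* §5 what the `#Sel_p = p²` density gives for free on the `100 %` set: root number `+1` with
  positive lower density (`hasPositiveLowerDensityOn_rootNumber_of_card_selmerGroup_eq_sq`, parity —
  so D9 contains the positivity half `ρ > 0` of I2, not its threshold) and the WEAK leaf `rank = 2 ∧
  Ш[p^∞] = 0` with positive lower density, with no Iwasawa input at all
  (`hasPositiveLowerDensityOn_rank_two_sha_bot_of_card_selmerGroup_eq_sq`, K1).

Consequence for the route (made BY NAME in the sibling levers file): the pair {I1, I2} may be
replaced by the single, strictly weaker crux D9 «in the door family the members with `#Sel₃ = 9`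
have positive lower density», or I1 by its capped form; all implications
`I1 ⇒ I1cap`, `I1cap ∧ I2 ⇒ D9` (mod `rank ≥ 2`, trivial torsion for `100 %` and D–D parity),
`D9 ⇒ leaf` (mod the published inputs at `3`) are theorems. No new definition, no named fact used
beyond the explicit hypothesis `hDD : even_selmerRank_sub_torsionRank_iff` of §3; standard axioms.
PARTITION: none — r_an ≥ 2, summit axis S0; TWIN (D-0056): n/a. B1 honesty: bookkeeping toward an
open crux; no analytic rank, no complex `L`-function; no S0 motion.

References: M. Bhargava, A. Shankar, Ann. of Math. 181 (2015) §1 (first moment + parity ⇒ positive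
proportion) [BhargavaShankarTernary2015]; T. Dokchitser, V. Dokchitser, Ann. of Math. 172 (2010)
(p-parity) [DokchitserDokchitserAnnals2010]; M. Bhargava, W. Ho, arXiv:2207.03309 (2022) Thm. 1.2
(averages over large subfamilies) [BhargavaHo2022]; B. Poonen, E. Rains, J. AMS 25 (2012)
(distribution heuristics for `Sel_p`) [PoonenRains2012].
-/

set_option linter.dupNamespace false

noncomputable section

open scoped Classical
open Filter Topology Finset
open WeierstrassCurve Literature.NumberTheory.EllipticCurves
  Literature.NumberTheory.EllipticCurves.BhargavaHo2022
  Summit.BirchSwinnertonDyer.Rank2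

namespace Summit.BirchSwinnertonDyer.BirchSwinnertonDyer.Theorems

variable (Φ : CongruenceFamily₂)

/-! ### §1 Density-algebra complements and the capped first moment -/

/-- Proportions are monotone in the property, the implication being needed on MEMBERS of `Φ` only
(the height balls consist of members). [folklore] -/
theorem proportionOn_mono_mem {P Q : Params → Prop} (h : ∀ a, Φ.Mem a → P a → Q a) (X : ℕ) :
    Φ.proportionOn P X ≤ Φ.proportionOn Q X := by
  rw [proportionOn_eq_card_filter_div Φ P X, proportionOn_eq_card_filter_div Φ Q X]
  gcongr with a ha
  exact h a ((Φ.mem_below_iff a X).1 ha).1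

/-- A lower density is inherited by properties weaker ON MEMBERS. [folklore] -/
theorem densityOnGE_mono_mem {P Q : Params → Prop} {δ : ℝ} (hP : Φ.DensityOnGE P δ)
    (h : ∀ a, Φ.Mem a → P a → Q a) : Φ.DensityOnGE Q δ := fun ε hε ↦
  (hP ε hε).mono fun X hX ↦ hX.trans (proportionOn_mono_mem Φ h X)

/-- A `100 %` property implies, for `100 %`, every property weaker ON MEMBERS. [folklore] -/
theorem hasDensityOn_one_mono_mem {P Q : Params → Prop} (hP : Φ.HasDensityOn P 1)
    (h : ∀ a, Φ.Mem a → P a → Q a) : Φ.HasDensityOn Q 1 :=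
  (hasDensityOn_one_iff_densityOnGE_one Φ Q).2
    (densityOnGE_mono_mem Φ ((hasDensityOn_one_iff_densityOnGE_one Φ P).1 hP) h)

/-- A positive lower density is inherited by properties weaker ON MEMBERS. [folklore] -/
theorem hasPositiveLowerDensityOn_mono_mem {P Q : Params → Prop}
    (hP : Φ.HasPositiveLowerDensityOn P) (h : ∀ a, Φ.Mem a → P a → Q a) :
    Φ.HasPositiveLowerDensityOn Q := by
  obtain ⟨δ, hδ, hev⟩ := hP
  exact ⟨δ, hδ, hev.mono fun X hX ↦ hX.trans (proportionOn_mono_mem Φ h X)⟩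

/-- If some property has lower density `≥ ρ > 0` in `Φ`, the height balls of `Φ` are eventually
nonempty (an empty ball has all proportions `0`). [folklore] -/
theorem eventually_card_below_pos_of_densityOnGE {P : Params → Prop} {ρ : ℝ}
    (hP : Φ.DensityOnGE P ρ) (hρ : 0 < ρ) : ∀ᶠ X : ℕ in atTop, 0 < (Φ.below X).card := by
  refine (hP (ρ / 2) (by linarith)).mono fun X hX ↦ ?_
  by_contra h0
  have hc : (Φ.below X).card = 0 := by omega
  have hp0 : Φ.proportionOn P X = 0 := by
    rw [proportionOn_eq_card_filter_div, hc, Nat.cast_zero, div_zero]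
  linarith

/-- If some property has positive lower density in `Φ`, the height balls of `Φ` are eventually
nonempty. [folklore] -/
theorem eventually_card_below_pos_of_hasPositiveLowerDensityOn {P : Params → Prop}
    (hP : Φ.HasPositiveLowerDensityOn P) : ∀ᶠ X : ℕ in atTop, 0 < (Φ.below X).card := by
  obtain ⟨δ, hδ, hPδ⟩ := exists_densityOnGE_of_hasPositiveLowerDensityOn Φ hP
  exact eventually_card_below_pos_of_densityOnGE Φ hPδ hδ

/-- **The capped first moment.** `limsup avg f ≤ c` implies `limsup avg min(f, M) ≤ c` for every
cap `M` (pointwise `min (f a) M ≤ f a`). In the route: I1 (`limsup avg #Sel₃ ≤ 36`) implies its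
CAPPED form `limsup avg min(#Sel₃, 81) ≤ 36`, which is all the first-moment door consumes.
[cite: BhargavaShankarTernary2015, §1 (first-moment method: only the levels below the cap enter)] -/
theorem averageOnLE_min {f : Params → ℝ} {c : ℝ} (hf : Φ.AverageOnLE f c) (M : ℝ) :
    Φ.AverageOnLE (fun a ↦ min (f a) M) c :=
  averageOnLE_mono Φ hf fun a _ ↦ min_le_left (f a) M

/-! ### §2 Trivial rational torsion kills `E(ℚ)[n]`; density-one adapters -/

section Torsion

variable {K : Type} [Field K] (W : WeierstrassCurve K)

/-- If `#E(K)_tors = 1` then `#E(K)[n] = 1` for every `n ≠ 0` (`E(K)[n] ⊆ E(K)_tors`, and a group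
of `Nat.card` one is trivial). [folklore] -/
theorem natCard_torsionBy_eq_one_of_torsionOrder_eq_one (h : W.torsionOrder = 1) {n : ℤ}
    (hn : n ≠ 0) : Nat.card (AddSubgroup.torsionBy W.toAffine.Point n) = 1 := by
  rw [WeierstrassCurve.torsionOrder, Nat.card_eq_one_iff_unique] at h
  obtain ⟨hsub, -⟩ := h
  rw [Nat.card_eq_one_iff_unique]
  refine ⟨⟨fun x y ↦ ?_⟩, ⟨0⟩⟩
  suffices hz : ∀ z : AddSubgroup.torsionBy W.toAffine.Point n, z = 0 by rw [hz x, hz y]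
  intro z
  have hmem : (z : W.toAffine.Point) ∈ AddCommGroup.torsion W.toAffine.Point := by
    rw [AddCommGroup.mem_torsion, isOfFinAddOrder_iff_zsmul_eq_zero]
    exact ⟨n, hn, (Submodule.mem_torsionBy_iff n (z : W.toAffine.Point)).mp z.2⟩
  have h0 : (⟨(z : W.toAffine.Point), hmem⟩ : AddCommGroup.torsion W.toAffine.Point) =
      ⟨0, AddSubgroup.zero_mem _⟩ := hsub.elim _ _
  exact Subtype.ext (by simpa using congrArg Subtype.val h0)

end Torsion

/-- **Density-one adapter (I0 form).** If trivial rational torsion and `rank ≥ 2` hold for `100 %`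
of `Φ` (the printed content of Bhargava–Ho Thm. 10.1 on a large family, route item I0), then for
every prime `p`, `rank ≥ 2 ∧ #E(ℚ)[p] = 1` holds for `100 %` of `Φ`. [cite: BhargavaHo2022, Thm. 10.1 and its proof (trivial torsion, rank ≥ 2 for 100 %)] -/
theorem hasDensityOn_rank_torsionBy_of_torsionOrder (p : ℕ) [Fact p.Prime]
    (h0 : Φ.HasDensityOn (fun a ↦ a.curve.torsionOrder = 1 ∧ 2 ≤ a.curve.mordellWeilRank) 1) :
    Φ.HasDensityOn (fun a ↦ 2 ≤ a.curve.mordellWeilRank ∧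
      Nat.card (AddSubgroup.torsionBy a.curve.toAffine.Point (p : ℤ)) = 1) 1 :=
  hasDensityOn_one_mono Φ h0 fun a h ↦ ⟨h.2, by
    -- `convert`: the generic-field lemma carries the classical `DecidableEq`, `ℚ` its own
    convert natCard_torsionBy_eq_one_of_torsionOrder_eq_one a.curve h.1
      (show ((p : ℕ) : ℤ) ≠ 0 by exact_mod_cast (Fact.out : p.Prime).ne_zero)⟩

/-- **Density-one adapter (door-family form).** If `rank ≥ 2` holds for `100 %` of `Φ` and EVERY
member has irreducible `ρ̄_p` (a Frobenius certificate at one auxiliary prime, as on the door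
family), then `rank ≥ 2 ∧ #E(ℚ)[p] = 1` holds for `100 %` of `Φ` (irreducible `E[p]` has no rational
line, tree theorem `natCard_torsionBy_eq_one_of_hasIrreducibleModPGaloisRep`). [folklore] -/
theorem hasDensityOn_rank_torsionBy_of_irreducible (p : ℕ) [Fact p.Prime]
    (hGen : Φ.HasDensityOn (fun a ↦ 2 ≤ a.curve.mordellWeilRank) 1)
    (hirr : ∀ a, Φ.Mem a → a.curve.HasIrreducibleModPGaloisRep p) :
    Φ.HasDensityOn (fun a ↦ 2 ≤ a.curve.mordellWeilRank ∧
      Nat.card (AddSubgroup.torsionBy a.curve.toAffine.Point (p : ℤ)) = 1) 1 :=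
  hasDensityOn_one_mono_mem Φ hGen fun a hmem h ↦ by
    haveI : a.curve.IsElliptic := a.isElliptic_curve hmem.1
    exact ⟨h, natCard_torsionBy_eq_one_of_hasIrreducibleModPGaloisRep a.curve p (hirr a hmem)⟩

/-! ### §3 The `#Sel_p = p²` density from the CAPPED first moment and parity -/

/-- **Positive lower density of `#Sel_p = p²` from the capped first moment** (first-moment method
with parity, distribution form). Let `Φ ⊆ F₂` be a subfamily on which `rank ≥ 2 ∧ #E(ℚ)[p] = 1`
holds for `100 %`, the CAPPED average satisfies `limsup avg min(#Sel_p(E_a), p⁴) ≤ A`, the root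
number is `+1` with lower density `≥ ρ > 0`, and `A < p³ + (p⁴ − p³)ρ`. Then, modulo
Dokchitser–Dokchitser `p`-parity (`hDD`), the members with `#Sel_p(E_a) = p²` have positive lower
density: member-wise `min(#Sel_p, p⁴) ≥ p³` when `w = −1` and `≥ p⁴` when `w = +1`, `#Sel_p ≠ p²`
(K2), on the `100 %` set; the density-zero exceptional set is absorbed into the levels.
[cite: BhargavaShankarTernary2015, §1 (first-moment method with parity)] -/
theorem hasPositiveLowerDensityOn_card_selmerGroup_eq_sq_of_cappedAverage (p : ℕ) [Fact p.Prime]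
    (hDD : even_selmerRank_sub_torsionRank_iff)
    (hGood : Φ.HasDensityOn (fun a ↦ 2 ≤ a.curve.mordellWeilRank ∧
      Nat.card (AddSubgroup.torsionBy a.curve.toAffine.Point (p : ℤ)) = 1) 1)
    {A ρ : ℝ}
    (hA : Φ.AverageOnLE (fun a ↦ min (Nat.card (a.curve.selmerGroup p) : ℝ) ((p : ℝ) ^ 4)) A)
    (hW : Φ.DensityOnGE (fun a ↦ a.curve.rootNumber = 1) ρ) (hρ : 0 < ρ)
    (hAρ : A < (p : ℝ) ^ 3 + ((p : ℝ) ^ 4 - (p : ℝ) ^ 3) * ρ) :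
    Φ.HasPositiveLowerDensityOn (fun a ↦ Nat.card (a.curve.selmerGroup p) = p ^ 2) := by
  have hp : p.Prime := Fact.out
  have hp1 : (1 : ℝ) ≤ p := by exact_mod_cast hp.one_lt.le
  have hp34 : (p : ℝ) ^ 3 ≤ (p : ℝ) ^ 4 := pow_le_pow_right₀ hp1 (by norm_num)
  have hp04 : (0 : ℝ) < (p : ℝ) ^ 4 := by positivity
  have hB := eventually_card_below_pos_of_densityOnGE Φ hW hρ
  -- the first-moment method on `f = min(#Sel_p, p⁴)`, exceptional set absorbed into `W` and `G`
  have key := hasPositiveLowerDensityOn_of_memberwise_bounds Φ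
    (f := fun a ↦ min (Nat.card (a.curve.selmerGroup p) : ℝ) ((p : ℝ) ^ 4))
    (W := fun a ↦ a.curve.rootNumber = 1 ∨ ¬ (2 ≤ a.curve.mordellWeilRank ∧
      Nat.card (AddSubgroup.torsionBy a.curve.toAffine.Point (p : ℤ)) = 1))
    (G := fun a ↦ Nat.card (a.curve.selmerGroup p) = p ^ 2 ∨ ¬ (2 ≤ a.curve.mordellWeilRank ∧
      Nat.card (AddSubgroup.torsionBy a.curve.toAffine.Point (p : ℤ)) = 1))
    (c_lo := 0) (c_mid := (p : ℝ) ^ 3) (c_hi := (p : ℝ) ^ 4) (A := A) (ρ := ρ) hp04 hp34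
    (fun a _ ↦ le_min (Nat.cast_nonneg _) hp04.le)
    (by
      intro a hmem hWa
      obtain ⟨hw, hgood⟩ := not_or.mp hWa
      obtain ⟨hrk, ht⟩ := not_not.mp hgood
      haveI : a.curve.IsElliptic := a.isElliptic_curve hmem.1
      have hw' : a.curve.rootNumber = -1 := (rootNumber_eq_one_or a.curve).resolve_left hw
      have h := (card_selmerGroup_bounds_of_rootNumber a.curve p hDD hrk ht).1 hw'
      exact le_min (by exact_mod_cast h) hp34)
    (by
      intro a hmem hWa hGa
      obtain ⟨hne, hgood⟩ := not_or.mp hGa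
      obtain ⟨hrk, ht⟩ := not_not.mp hgood
      have hw : a.curve.rootNumber = 1 := hWa.resolve_right (not_not.mpr ⟨hrk, ht⟩)
      haveI : a.curve.IsElliptic := a.isElliptic_curve hmem.1
      have h := (card_selmerGroup_bounds_of_rootNumber a.curve p hDD hrk ht).2 hw hne
      exact le_min (by exact_mod_cast h) le_rfl)
    hA (densityOnGE_mono Φ hW fun a h ↦ Or.inl h) hB (by linarith)
  have key2 := hasPositiveLowerDensityOn_and_of_hasDensityOn_one Φ hGood key
  exact hasPositiveLowerDensityOn_mono Φ key2 fun a h ↦ h.2.resolve_right (not_not.mpr h.1)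

/-- **At `p = 3`**: on any `Φ ⊆ F₂` on which `rank ≥ 2 ∧ #E(ℚ)[3] = 1` holds for `100 %`, a capped
`3`-Selmer average `limsup avg min(#Sel₃(E_a), 81) ≤ A`, root number `+1` with lower density
`≥ ρ > 0` and `A < 27 + 54ρ` give a POSITIVE LOWER DENSITY of members with `#Sel₃(E_a) = 9`
(modulo D–D `3`-parity). With `A = 36` the threshold is `ρ > 1/6` (the route's I1cap ∧ I2 ⇒ D9).
[cite: BhargavaShankarTernary2015, §1 (first-moment method with parity)] -/
theorem hasPositiveLowerDensityOn_selmerNine_of_cappedAverage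
    (hDD : even_selmerRank_sub_torsionRank_iff)
    (hGood : Φ.HasDensityOn (fun a ↦ 2 ≤ a.curve.mordellWeilRank ∧
      Nat.card (AddSubgroup.torsionBy a.curve.toAffine.Point (3 : ℤ)) = 1) 1)
    {A ρ : ℝ} (hA : Φ.AverageOnLE (fun a ↦ min (Nat.card (a.curve.selmerGroup 3) : ℝ) 81) A)
    (hW : Φ.DensityOnGE (fun a ↦ a.curve.rootNumber = 1) ρ) (hρ : 0 < ρ)
    (hAρ : A < 27 + 54 * ρ) :
    Φ.HasPositiveLowerDensityOn (fun a ↦ Nat.card (a.curve.selmerGroup 3) = 9) := by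
  have h := hasPositiveLowerDensityOn_card_selmerGroup_eq_sq_of_cappedAverage Φ 3 hDD
    (by exact_mod_cast hGood) (A := A) (ρ := ρ) (by norm_num; exact hA) hW hρ (by norm_num; linarith)
  norm_num at h
  exact h

/-! ### §4 The door consumes only the `#Sel_p = p²` density -/

/-- **The door consumes only the `#Sel_p = p²` density.** Let `Good` hold for `100 %` of `Φ` and let
`Leaf` follow member-wise from `Good` and `#Sel_p(E_a) = p²` (the per-member door: in the route,
`Good` = `rank ≥ 2` ∧ Schneider at `3` on the rank-two minimal models, `Leaf` = the leaf's property,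
door = `Theorems.countingDoor_leaf_of_member` on the door family). If the members with
`#Sel_p(E_a) = p²` have positive lower density, so do the members with `Leaf` — no root number, no
parity, no average is used. [folklore] -/
theorem hasPositiveLowerDensityOn_of_door_of_card_selmerGroup_eq_sq {p : ℕ}
    {Good Leaf : Params → Prop} (hGood : Φ.HasDensityOn Good 1)
    (hD : Φ.HasPositiveLowerDensityOn (fun a ↦ Nat.card (a.curve.selmerGroup p) = p ^ 2))
    (hdoor : ∀ a, Φ.Mem a → Good a → Nat.card (a.curve.selmerGroup p) = p ^ 2 → Leaf a) :
    Φ.HasPositiveLowerDensityOn Leaf :=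
  hasPositiveLowerDensityOn_mono_mem Φ (hasPositiveLowerDensityOn_and_of_hasDensityOn_one Φ hGood hD)
    fun a hmem h ↦ hdoor a hmem h.1 h.2

/-- **The whole chain, distribution form.** On `Φ ⊆ F₂`: `rank ≥ 2 ∧ #E(ℚ)[p] = 1` for `100 %`,
`Good` for `100 %`, a capped average `limsup avg min(#Sel_p, p⁴) ≤ A`, root number `+1` with lower
density `≥ ρ > 0`, `A < p³ + (p⁴ − p³)ρ`, and a member-wise door `Good a → #Sel_p(E_a) = p² → Leaf a`
give a positive lower density of `Leaf` (modulo D–D parity). [cite: BhargavaShankarTernary2015, §1 (first-moment method with parity)] -/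
theorem hasPositiveLowerDensityOn_of_door_of_cappedAverage (p : ℕ) [Fact p.Prime]
    {Good Leaf : Params → Prop} (hDD : even_selmerRank_sub_torsionRank_iff)
    (hGen : Φ.HasDensityOn (fun a ↦ 2 ≤ a.curve.mordellWeilRank ∧
      Nat.card (AddSubgroup.torsionBy a.curve.toAffine.Point (p : ℤ)) = 1) 1)
    (hGood : Φ.HasDensityOn Good 1) {A ρ : ℝ}
    (hA : Φ.AverageOnLE (fun a ↦ min (Nat.card (a.curve.selmerGroup p) : ℝ) ((p : ℝ) ^ 4)) A)
    (hW : Φ.DensityOnGE (fun a ↦ a.curve.rootNumber = 1) ρ) (hρ : 0 < ρ)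
    (hAρ : A < (p : ℝ) ^ 3 + ((p : ℝ) ^ 4 - (p : ℝ) ^ 3) * ρ)
    (hdoor : ∀ a, Φ.Mem a → Good a → Nat.card (a.curve.selmerGroup p) = p ^ 2 → Leaf a) :
    Φ.HasPositiveLowerDensityOn Leaf :=
  hasPositiveLowerDensityOn_of_door_of_card_selmerGroup_eq_sq Φ hGood
    (hasPositiveLowerDensityOn_card_selmerGroup_eq_sq_of_cappedAverage Φ p hDD hGen hA hW hρ hAρ)
    hdoor

/-! ### §5 What the `#Sel_p = p²` density gives for free: root number `+1` and the weak leaf -/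

/-- **Member-wise: `#Sel_p(E) = p²` and `#E(ℚ)[p] = 1` force root number `+1`** (Dokchitser–Dokchitser
`p`-parity in counting form, `hDD`, with `s = 2`, `t = 0`: `s - t` is even). No rank hypothesis.
[cite: DokchitserDokchitserAnnals2010, Thm 1.4 (p-parity)] -/
theorem rootNumber_eq_one_of_card_selmerGroup_eq_sq (W : WeierstrassCurve ℚ) [W.IsElliptic]
    (p : ℕ) [Fact p.Prime] (hDD : even_selmerRank_sub_torsionRank_iff)
    (hSel : Nat.card (W.selmerGroup p) = p ^ 2)
    (ht : Nat.card (AddSubgroup.torsionBy W.toAffine.Point (p : ℤ)) = 1) : W.rootNumber = 1 := by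
  have ht' : Nat.card (AddSubgroup.torsionBy W.toAffine.Point (p : ℤ)) = p ^ 0 := by
    rw [pow_zero]; exact ht
  have hpar : Even ((2 : ℕ) : ℤ) ↔ W.rootNumber = 1 := by simpa using hDD W p 2 0 hSel ht'
  exact hpar.mp ⟨1, by norm_num⟩

/-- **The `#Sel_p = p²` density carries a positive density of root number `+1`.** On any `Φ` on
which `rank ≥ 2 ∧ #E(ℚ)[p] = 1` holds for `100 %`, a positive lower density of members with
`#Sel_p(E_a) = p²` gives a positive lower density of members with root number `+1` (parity, member by
member). So the nine-density D9 contains the POSITIVITY half of the route's I2 (`ρ > 0`), though not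
its threshold `ρ > 1/6` nor any first moment. [cite: DokchitserDokchitserAnnals2010, Thm 1.4 (p-parity)] -/
theorem hasPositiveLowerDensityOn_rootNumber_of_card_selmerGroup_eq_sq (p : ℕ) [Fact p.Prime]
    (hDD : even_selmerRank_sub_torsionRank_iff)
    (hGood : Φ.HasDensityOn (fun a ↦ 2 ≤ a.curve.mordellWeilRank ∧
      Nat.card (AddSubgroup.torsionBy a.curve.toAffine.Point (p : ℤ)) = 1) 1)
    (hD : Φ.HasPositiveLowerDensityOn (fun a ↦ Nat.card (a.curve.selmerGroup p) = p ^ 2)) :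
    Φ.HasPositiveLowerDensityOn (fun a ↦ a.curve.rootNumber = 1) :=
  hasPositiveLowerDensityOn_of_door_of_card_selmerGroup_eq_sq Φ hGood hD fun a hmem hgood hSel ↦ by
    haveI : a.curve.IsElliptic := a.isElliptic_curve hmem.1
    exact rootNumber_eq_one_of_card_selmerGroup_eq_sq a.curve p hDD hSel hgood.2

/-- **The `#Sel_p = p²` density gives the WEAK leaf with no Iwasawa theory.** On any `Φ` on which
`rank ≥ 2 ∧ #E(ℚ)[p] = 1` holds for `100 %`, a positive lower density of members with
`#Sel_p(E_a) = p²` gives a positive lower density of members with `rank E_a(ℚ) = 2` and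
`Ш(E_a)[p^∞] = 0` (K1 `Rank2.rank_eq_two_and_sha_eq_bot_of_card_selmerGroup_rat`, member by member;
no parity, no main conjecture, no height). [folklore] -/
theorem hasPositiveLowerDensityOn_rank_two_sha_bot_of_card_selmerGroup_eq_sq (p : ℕ) [Fact p.Prime]
    (hGood : Φ.HasDensityOn (fun a ↦ 2 ≤ a.curve.mordellWeilRank ∧
      Nat.card (AddSubgroup.torsionBy a.curve.toAffine.Point (p : ℤ)) = 1) 1)
    (hD : Φ.HasPositiveLowerDensityOn (fun a ↦ Nat.card (a.curve.selmerGroup p) = p ^ 2)) :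
    Φ.HasPositiveLowerDensityOn (fun a ↦ a.IsMember ∧ a.curve.mordellWeilRank = 2 ∧
      AddCommGroup.primaryComponent a.curve.sha p = ⊥) :=
  hasPositiveLowerDensityOn_of_door_of_card_selmerGroup_eq_sq Φ hGood hD fun a hmem hgood hSel ↦ by
    haveI : a.curve.IsElliptic := a.isElliptic_curve hmem.1
    exact ⟨hmem.1, rank_eq_two_and_sha_eq_bot_of_card_selmerGroup_rat a.curve p hSel hgood.1 hgood.2⟩

end Summit.BirchSwinnertonDyer.BirchSwinnertonDyer.Theorems

end
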